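import Summits.BirchSwinnertonDyer.BirchSwinnertonDyer.Theorems.RamifiedSevenEllipticUnitsRelativeValuationOfDatum
import HarnessLib

set_option linter.dupNamespace false
set_option autoImplicit false

/-!
# K7r crux `EllipticUnitValueSevenOfGZK` (stmt-BirchSwinnertonDyer-19945), line `rubin-formula-zp`, stub
# S_relval — the relative Rubin valuation theorem on the typed datum, ON S_relval's CARRIER: with the de
# Rham generators PINNED `ξ₁ = φ·(φ∘c)⁻¹` (planner LEMMA Ξ) the interpolated character is `φ^{2k+1}` and
# the central values are `heckePowerCentralValue φ k` (cell `bsd-cm`, seat `bsd-cm-k7r-c3` g9; helper,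
# `--supports` 19945; companion of `…RelativeValuationOfDatum.lean` p493974)

HONEST FRAMING. Nothing is asserted about the crux or any curve; no definition, no named fact,
`sorry`-free; BSD is not proved by any of this. The companion proves, for two `RubinPadicLFunctionData`
(member `R`, base `R₀`; [BKNO] arXiv:2608.06879 as fields of the data, unrefereed), that
`‖[T⁰]ℒ_W‖² = p^(−padicValRat p r)` where `r = (L/L₀)²` for the central values of the characters
`φ^{k+1}(φ∘c)^k ξ₁^k` interpolated by Thm. 4.12. The cell's S_relval speaks of `φ^{2k+1}`
(`X12.O11.heckePowerCentralValue φ k`). The planner's LEMMA Ξ (STATUS 2026-08-27T03:54:59Z; paper,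
referee countersign asked): for `E/ℚ` with CM by `𝒪_K`, `K = ℚ(√−7)`, `p = 7`, BKNO's `η_ac = 𝟙`, so
`ξ₁ = φ_ac = φ·(φ∘c)⁻¹` — whence `φ^{k+1}(φ∘c)^k ξ₁^k = φ^{2k+1}`. Until the typing layer exposes BKNO's
`η` (micro-ask to littype-10), the pin is carried as the HYPOTHESES `hξ`, `hξ₀` (planner to the line
owner: "your v4 may carry `hξ : R.ξ = φ * (galConj c φ)⁻¹` as an explicit hypothesis"). THIS FILE:
`interpolatedCharacter_eq_pow` (group algebra), `heckeCentralValue_pow_eq` (the carrier identity, by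
`rfl`, in unfolded form — no Summits statement module imported), and the two theorems of the companion
restated on the carrier: `norm_constantCoeff_sq_eq_of_data_of_xi`, `natCast_eq_padicValRat_of_data_of_xi`.
References: [BKNO] arXiv:2608.06879 Def. 4.2 ff., Thm. 4.12, Thm. 7.2 [BurungaleKobayashiNakamuraOta2026];
cell STATUS D131, LEMMA Ξ; memo RELATIVE-RUBIN-ram-g9.md §1 (i).
-/

noncomputable section

open scoped Classical NNReal

namespace Summit.BirchSwinnertonDyer.BirchSwinnertonDyer.Theorems.RamifiedSevenEllipticUnits

open NumberField IsDedekindDomain Field PowerSeries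
  Literature.NumberTheory.EllipticCurves
  Literature.NumberTheory.EllipticCurves.BurungaleKobayashiNakamuraOta2026
  Literature.NumberTheory.GaloisRepresentations
  Literature.NumberTheory.DiophantineGeometry

/-! ## With the de Rham generator PINNED, `ξ₁ = φ·(φ∘c)⁻¹` (planner LEMMA Ξ, STATUS
2026-08-27T03:54:59Z: `η_ac = 𝟙` for `E/ℚ` with CM by `𝒪_K`, `K = ℚ(√−7)`, `p = 7`): the interpolated
character IS `φ^{2k+1}` and the theorem reads on S_relval's carrier `heckePowerCentralValue φ k =
heckeCentralValue (φ^(2k+1)) k` — the pins `hξ`, `hξ₀` are HYPOTHESES here (dischargeable by Lemma Ξ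
once the typing layer exposes BKNO's `η`; planner: "your v4 may carry `hξ` as an explicit hypothesis") -/

namespace RelativeValuationOfDatum

open Ultrametric HvanAnatomy

variable {W W₀ : WeierstrassCurve ℚ} [W.IsElliptic] [W₀.IsElliptic] {p : ℕ} [hp : Fact p.Prime]
  {K : Type} [Field K] [NumberField K] {c : K ≃ₐ[ℚ] K} {𝔭 : HeightOneSpectrum (𝓞 K)}
  {κ : ZpExtension K p} {γ : absoluteGaloisGroup K} {ι : PadicAlgCl p ≃+* ℂ}
  {φ φ₀ : HeckeCharacter K} {Ω Ω₀ : ℂ}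
  {𝓔 : AcDualExpSystem W p K 𝔭 κ ι} {𝓔₀ : AcDualExpSystem W₀ p K 𝔭 κ ι}
  {D : EllipticUnitClassData W p K 𝔭 κ γ ι φ Ω 𝓔}
  {D₀ : EllipticUnitClassData W₀ p K 𝔭 κ γ ι φ₀ Ω₀ 𝓔₀}
  (R : RubinPadicLFunctionData W p K c 𝔭 κ γ ι φ Ω 𝓔 D)
  (R₀ : RubinPadicLFunctionData W₀ p K c 𝔭 κ γ ι φ₀ Ω₀ 𝓔₀ D₀)

/-- **Group algebra of LEMMA Ξ's consequence**: if `ξ₁ = φ·(φ∘c)⁻¹` then the character interpolated by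
Thm. 4.12 at `χ = 𝟙`, `φ^{k+1}(φ∘c)^k ξ₁^k · 𝟙`, IS `φ^{2k+1}` (in the commutative group of Hecke
characters). [cite: BurungaleKobayashiNakamuraOta2026, Def. 4.2 ff. (arXiv:2608.06879 p. 26) (`ξ = φ_ac^k η_ac^{−k} χ`; shape only)] -/
theorem interpolatedCharacter_eq_pow {ξ₁ : HeckeCharacter K}
    (hξ : ξ₁ = φ * (HeckeCharacter.galConj c φ)⁻¹) (k : ℕ) :
    φ ^ (k + 1) * HeckeCharacter.galConj c φ ^ k * ξ₁ ^ k * 1 = φ ^ (2 * k + 1) := by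
  subst hξ
  rw [mul_one, mul_pow, inv_pow, mul_assoc, mul_left_comm (HeckeCharacter.galConj c φ ^ k),
    mul_inv_cancel, mul_one, ← pow_add]
  congr 1
  ring

/-- `heckeCentralValue (φ^(2k+1)) k` is LITERALLY S_relval's carrier `X12.O11.heckePowerCentralValue φ k`
(both unfold to `LFunction.entireContinuationFrom (k + 3/2) (heckeLFunction (φ^(2k+1))) (k + 1)`; stated
here in unfolded form so that this file need not import the Summits statement layer).
[cite: BurungaleKobayashiNakamuraOta2026, Thm. 4.12 (arXiv:2608.06879 p. 32) (the value interpolated; shape only)] -/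
theorem heckeCentralValue_pow_eq (φ : HeckeCharacter K) (k : ℕ) :
    heckeCentralValue (φ ^ (2 * k + 1)) k =
      LFunction.entireContinuationFrom ((k : ℝ) + 3 / 2) (heckeLFunction (φ ^ (2 * k + 1)))
        ((k : ℂ) + 1) :=
  rfl

/-- **THE RELATIVE RUBIN VALUATION THEOREM ON THE DATUM, ON S_relval's CARRIER** (`k = p^m`): as
`norm_constantCoeff_sq_eq_of_data`, with the two de Rham generators PINNED (`hξ : R.ξ = φ·(φ∘c)⁻¹`,
`hξ₀`; LEMMA Ξ) so that signs, ramification and the carrier are stated for `φ^{2k+1}`, `φ₀^{2k+1}`: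
`(heckeCentralValue (φ^(2k+1)) k / heckeCentralValue (φ₀^(2k+1)) k)² = r` — i.e. S_relval's
`(heckePowerCentralValue φ (p^m) / heckePowerCentralValue φ₀ (p^m))² = r` — and
`padicValRat p r < 1 + 2m` give `‖[T⁰]R.L‖² = p^(−padicValRat p r)` and `[T⁰]R.L ≠ 0`.
[cite: BurungaleKobayashiNakamuraOta2026, Thm. 4.12 and Def. 4.7 (arXiv:2608.06879 pp. 27, 32) (claim; preprint; fields of the datum)] -/
theorem norm_constantCoeff_sq_eq_of_data_of_xi (h5 : 5 ≤ p) (m : ℕ)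
    (hξ : R.ξ = φ * (HeckeCharacter.galConj c φ)⁻¹)
    (hξ₀ : R₀.ξ = φ₀ * (HeckeCharacter.galConj c φ₀)⁻¹)
    (hsgn : IsCentralRootNumberWt (φ ^ (2 * p ^ m + 1)) (p ^ m) 1)
    (hsgn₀ : IsCentralRootNumberWt (φ₀ ^ (2 * p ^ m + 1)) (p ^ m) 1)
    (hram : ∀ w, (w = 𝔭 ∨ ¬ φ.IsUnramifiedAt w) → ¬ (φ ^ (2 * p ^ m + 1)).IsUnramifiedAt w)
    (hram₀ : ∀ w, (w = 𝔭 ∨ ¬ φ₀.IsUnramifiedAt w) → ¬ (φ₀ ^ (2 * p ^ m + 1)).IsUnramifiedAt w)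
    (hΩ : Ω ≠ 0) (hΩ₀ : Ω₀ ≠ 0)
    (hu : ‖avatarValueAt R.r γ - 1‖ ^ 2 = ((p : ℝ))⁻¹)
    (hu₀ : ‖avatarValueAt R₀.r γ - 1‖ ^ 2 = ((p : ℝ))⁻¹)
    (hbase : ‖((PowerSeries.constantCoeff R₀.L : PadicComplexInt p) : ℂ_[p])‖ = 1)
    (hper : ‖R.δ (p ^ m) 1 * ((ι.symm (Ω ^ (2 * p ^ m + 1)) : PadicAlgCl p) : ℂ_[p])‖ =
      ‖R₀.δ (p ^ m) 1 * ((ι.symm (Ω₀ ^ (2 * p ^ m + 1)) : PadicAlgCl p) : ℂ_[p])‖)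
    {r : ℚ} (hr : r ≠ 0)
    (hρ : (heckeCentralValue (φ ^ (2 * p ^ m + 1)) (p ^ m) /
        heckeCentralValue (φ₀ ^ (2 * p ^ m + 1)) (p ^ m)) ^ 2 = (r : ℂ))
    (hlt : padicValRat p r < 1 + 2 * (m : ℤ)) :
    ‖((PowerSeries.constantCoeff R.L : PadicComplexInt p) : ℂ_[p])‖ ^ 2 = (p : ℝ) ^ (-padicValRat p r) ∧
      ((PowerSeries.constantCoeff R.L : PadicComplexInt p) : ℂ_[p]) ≠ 0 := by
  have e := interpolatedCharacter_eq_pow (c := c) (φ := φ) hξ (p ^ m)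
  have e₀ := interpolatedCharacter_eq_pow (c := c) (φ := φ₀) hξ₀ (p ^ m)
  refine norm_constantCoeff_sq_eq_of_data R R₀ h5 m ?_ ?_ ?_ ?_ hΩ hΩ₀ hu hu₀ hbase hper hr ?_ hlt
  · rw [e]; exact hsgn
  · rw [e₀]; exact hsgn₀
  · rw [e]; exact hram
  · rw [e₀]; exact hram₀
  · rw [e, e₀]; exact hρ

/-- **Corollary on S_relval's carrier with the (R3) reading**: `(l : ℤ) = padicValRat p r`.
[cite: BurungaleKobayashiNakamuraOta2026, Thm. 4.12, Def. 4.7 and Thm. 7.2 (arXiv:2608.06879 pp. 27, 32, 41) (claim; preprint; fields of the datum)] -/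
theorem natCast_eq_padicValRat_of_data_of_xi (h5 : 5 ≤ p) (m : ℕ)
    (hξ : R.ξ = φ * (HeckeCharacter.galConj c φ)⁻¹)
    (hξ₀ : R₀.ξ = φ₀ * (HeckeCharacter.galConj c φ₀)⁻¹)
    (hsgn : IsCentralRootNumberWt (φ ^ (2 * p ^ m + 1)) (p ^ m) 1)
    (hsgn₀ : IsCentralRootNumberWt (φ₀ ^ (2 * p ^ m + 1)) (p ^ m) 1)
    (hram : ∀ w, (w = 𝔭 ∨ ¬ φ.IsUnramifiedAt w) → ¬ (φ ^ (2 * p ^ m + 1)).IsUnramifiedAt w)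
    (hram₀ : ∀ w, (w = 𝔭 ∨ ¬ φ₀.IsUnramifiedAt w) → ¬ (φ₀ ^ (2 * p ^ m + 1)).IsUnramifiedAt w)
    (hΩ : Ω ≠ 0) (hΩ₀ : Ω₀ ≠ 0)
    (hu : ‖avatarValueAt R.r γ - 1‖ ^ 2 = ((p : ℝ))⁻¹)
    (hu₀ : ‖avatarValueAt R₀.r γ - 1‖ ^ 2 = ((p : ℝ))⁻¹)
    (hbase : ‖((PowerSeries.constantCoeff R₀.L : PadicComplexInt p) : ℂ_[p])‖ = 1)
    (hper : ‖R.δ (p ^ m) 1 * ((ι.symm (Ω ^ (2 * p ^ m + 1)) : PadicAlgCl p) : ℂ_[p])‖ =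
      ‖R₀.δ (p ^ m) 1 * ((ι.symm (Ω₀ ^ (2 * p ^ m + 1)) : PadicAlgCl p) : ℂ_[p])‖)
    {r : ℚ} (hr : r ≠ 0)
    (hρ : (heckeCentralValue (φ ^ (2 * p ^ m + 1)) (p ^ m) /
        heckeCentralValue (φ₀ ^ (2 * p ^ m + 1)) (p ^ m)) ^ 2 = (r : ℂ))
    (hlt : padicValRat p r < 1 + 2 * (m : ℤ)) {l : ℕ}
    (hbottom : ‖((PowerSeries.constantCoeff R.L : PadicComplexInt p) : ℂ_[p])‖ ^ 2 =
      (p : ℝ) ^ (-(l : ℤ))) :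
    (l : ℤ) = padicValRat p r := by
  have hp0 : (0 : ℝ) < (p : ℝ) := by exact_mod_cast hp.out.pos
  have hp1 : (p : ℝ) ≠ 1 := by exact_mod_cast hp.out.ne_one
  have h := (norm_constantCoeff_sq_eq_of_data_of_xi R R₀ h5 m hξ hξ₀ hsgn hsgn₀ hram hram₀ hΩ hΩ₀ hu hu₀
    hbase hper hr hρ hlt).1
  rw [hbottom] at h
  have h3 := zpow_right_injective₀ hp0 hp1 h
  simp only [neg_inj] at h3
  exact h3

end RelativeValuationOfDatum

end Summit.BirchSwinnertonDyer.BirchSwinnertonDyer.Theorems.RamifiedSevenEllipticUnits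

end
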